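import Summits.BirchSwinnertonDyer.BirchSwinnertonDyer.Theorems.ThetaPartnerAtTwoSignedControlAtTwoDivOfShaTwoAnyField
import Literature.NumberTheory.EllipticCurves.IwasawaNoFiniteSubmoduleProofs
import HarnessLib

/-!
# Greenberg's Prop. 4.9 / 4.12 CONCLUSION for the full group `H¹(K_∞, E[p^∞])` from `Ш²(K, E[p^∞]) = 0`:
# its Pontryagin dual has `Y[T] = 0`, hence no nonzero finite `Λ`-submodule — every `K`, `p`, `K_∞`, `E`
# (crux K4 `SignedControlAtTwo`, stmt-BirchSwinnertonDyer-20309, PROP412-BYPASS corollary)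

Route `ThetaPartnerAtTwo` (TP2; crux shared with `ResidualThetaTransportAtTwo`), crux K4, memo
`Cruxes/SignedControlAtTwo/PROP412-BYPASS.md` (seat `bsd-inputs-k4-p1`). THEOREMS ONLY (no definition, no
named fact, no `sorry`).

Greenberg, LNM 1716, Prop. 4.9 (p. 113) / Prop. 4.12 (p. 119): «`H¹(F_Σ/F_∞, E[p^∞])` has no proper
`Λ`-submodule of finite index» (dually: its Pontryagin dual has no nonzero finite `Λ`-submodule), proved in
print through the `Λ`-adic `H²(F_Σ/F, Hom(Λ, E[p^∞]))` (pp. 114–118).  The seat's level-`K` road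
(`…DivOfShaTwoAnyField`: `Ш²(K, E[p^∞]) = 0 ⟹ (γ−1)·H¹(K_∞, E[p^∞]) = H¹(K_∞, E[p^∞])`) gives the same
SHAPE of conclusion for the FULL group `H¹(K_∞, E[p^∞]) = H¹(Gal(K̄/K_∞), E[p^∞])`, for every number field
`K`, prime `p`, `ℤ_p`-extension `κ` with topological generator `γ`, and elliptic `W/K`:

* `dual_invariants_eq_bot_of_shaTwo_eq_bot` — for every `Λ`-module `Y` with an INJECTIVE additive map
  `dY : Y → Hom(H¹(K_∞, E[p^∞]), ℚ/ℤ)` under which `T` acts as `conj_γ − 1` (the Pontryagin-dual datum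
  axiom of `Greenberg1999.prop49_noFiniteSubmodule_H1Sigma` / `prop412_…`, for the full group), **`Y[T] = 0`**;
* `dual_forall_finite_eq_bot_of_shaTwo_eq_bot` — hence **`Y` has no nonzero finite `Λ`-submodule**
  (a finite `Λ`-module is killed by a power of `p` and meets `Y[T]`, tree
  `IwasawaAlgebra.forall_finite_eq_bot_of_forall_pow_smul_invariants_eq_zero`).

So for the full group, Greenberg's «no proper finite-index submodule» follows from ONE generic global-duality
statement, `Ш²(K, E[p^∞]) = 0` (⟸ `poitouTate_sha_tateDual K` + `Sel_{p^∞}(E/K)` finite + `E[p^∞]^{Γ_K} = 0`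
+ the real-place `2`-divisibility, width seat w2 g5's lane), with NO cotorsion / corank / weak-Leopoldt
hypothesis.  (For the `Σ`-unramified subgroup `H¹(K_Σ/K_∞, E[p^∞]) ⊆ H¹(K_∞, E[p^∞])` of the printed
statement one adds the Cassels lift, as the line's doors do.)  BSD is not proved by any of this; closes no
item by itself.

References: [GreenbergLNM1716] §4 Appendix Prop. 4.9 (p. 113), Prop. 4.12 (p. 119), pp. 114–118;
[MilneADT2006] I Thm. 4.10; [Washington1997] §13.2 (finite `Λ`-modules).
-/

set_option autoImplicit false
-- the Theorems namespace of this sub repeats the summit name by design (D-0017 nested layout)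
set_option linter.dupNamespace false

noncomputable section

open scoped Classical NumberField

namespace Summit.BirchSwinnertonDyer.BirchSwinnertonDyer.Theorems.SignedEC.PrimaryTorsionH2

open Function NumberField IsDedekindDomain Field WeierstrassCurve
open Literature.NumberTheory.EllipticCurves Literature.NumberTheory.GaloisRepresentations
  Literature.NumberTheory.EllipticCurves.IwasawaAlgebra
open Summit.BirchSwinnertonDyer.Rank1Residual.X11b

variable {K : Type} [Field K] [NumberField K] (W : WeierstrassCurve K) [W.IsElliptic]
  (p : ℕ) [hp : Fact p.Prime] (κ : ZpExtension K p) {γ : absoluteGaloisGroup K}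

/-- **`Ш²(K, E[p^∞]) = 0 ⟹ Y[T] = 0`** for every `Λ`-module `Y` mapped INJECTIVELY into
`Hom(H¹(K_∞, E[p^∞]), ℚ/ℤ)` with `T` acting as `conj_γ − 1` (Pontryagin-dual datum of the full group
`H¹(Gal(K̄/K_∞), E[p^∞])`, `γ` a topological generator): a `T`-fixed functional vanishes on
`(conj_γ − 1) H¹ = H¹` (`forall_exists_conjH1_sub_eq_of_shaTwo_eq_bot`).
[cite: GreenbergLNM1716, §4 Appendix Prop. 4.12 (p. 119) and p. 104] -/
theorem dual_invariants_eq_bot_of_shaTwo_eq_bot (hγ : κ.IsTopGenerator γ)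
    (hsha : DiscreteGaloisModule.shaTwo (LocBridge.primaryGaloisModule W p) = ⊥)
    {Y : Type*} [AddCommGroup Y] [Module (IwasawaAlgebra p) Y]
    (dY : Y →+ (W.subgroupH1 p κ.kerSubgroup →+ AddCircle (1 : ℚ))) (hinj : Function.Injective dY)
    (hT : ∀ (y : Y) (x : W.subgroupH1 p κ.kerSubgroup),
      dY ((PowerSeries.X : IwasawaAlgebra p) • y) x = dY y (W.conjH1 p κ.kerSubgroup γ x) - dY y x) :
    invariants p Y = ⊥ := by
  rw [eq_bot_iff]
  intro y hy
  rw [Submodule.mem_bot]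
  rw [mem_invariants_iff] at hy
  apply hinj
  rw [map_zero]
  ext s
  obtain ⟨t, ht⟩ := forall_exists_conjH1_sub_eq_of_shaTwo_eq_bot W p κ hγ hsha s
  have h := hT y t
  rw [hy, map_zero, AddMonoidHom.zero_apply] at h
  rw [← ht, map_sub, AddMonoidHom.zero_apply]
  exact h.symm

/-- **`Ш²(K, E[p^∞]) = 0 ⟹` the Pontryagin dual of `H¹(K_∞, E[p^∞])` has NO nonzero finite `Λ`-submodule**
(Greenberg's Prop. 4.9 / 4.12 conclusion, for the full group `H¹(Gal(K̄/K_∞), E[p^∞])`, every number field,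
prime, `ℤ_p`-extension and elliptic curve): `Y[T] = 0` (`dual_invariants_eq_bot_of_shaTwo_eq_bot`) and a
nonzero finite `Λ`-submodule would meet `Y[T]`
(`IwasawaAlgebra.forall_finite_eq_bot_of_forall_pow_smul_invariants_eq_zero`).
[cite: GreenbergLNM1716, §4 Appendix Prop. 4.9 (p. 113) and Prop. 4.12 (p. 119)] [cite: Washington1997, §13.2] -/
theorem dual_forall_finite_eq_bot_of_shaTwo_eq_bot (hγ : κ.IsTopGenerator γ)
    (hsha : DiscreteGaloisModule.shaTwo (LocBridge.primaryGaloisModule W p) = ⊥)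
    {Y : Type*} [AddCommGroup Y] [Module (IwasawaAlgebra p) Y]
    (dY : Y →+ (W.subgroupH1 p κ.kerSubgroup →+ AddCircle (1 : ℚ))) (hinj : Function.Injective dY)
    (hT : ∀ (y : Y) (x : W.subgroupH1 p κ.kerSubgroup),
      dY ((PowerSeries.X : IwasawaAlgebra p) • y) x = dY y (W.conjH1 p κ.kerSubgroup γ x) - dY y x) :
    ∀ N : Submodule (IwasawaAlgebra p) Y, Finite N → N = ⊥ := by
  have hbot := dual_invariants_eq_bot_of_shaTwo_eq_bot W p κ hγ hsha dY hinj hT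
  refine forall_finite_eq_bot_of_forall_pow_smul_invariants_eq_zero p fun x hx _ _ ↦ ?_
  rw [hbot] at hx
  exact (Submodule.mem_bot _).mp hx

end Summit.BirchSwinnertonDyer.BirchSwinnertonDyer.Theorems.SignedEC.PrimaryTorsionH2

end
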